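import Mathlib.Algebra.MvPolynomial.PDeriv
import Mathlib.RingTheory.MvPolynomial.Basic
import Mathlib.Data.Finsupp.Lex
import Mathlib.Data.Finset.Sort
import Mathlib.Data.Finsupp.Weight
import HarnessLib

/-!
# Forbes 2015 (shifted partial derivatives) — definitions

M. A. Forbes, *Deterministic divisibility testing via shifted partial derivatives*, FOCS 2015
(doi:10.1109/FOCS.2015.35; held `paper:doi-10-1109-focs-2015-35`), §3.2–§3.3 (monomial orders,
trailing monomials), §5.2/§6 (the measure `x^{≤ℓ}((x+α)∘∂_x)^{≤k}`), Lemma 4.12 (the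
projection `π_S`), Lemma 4.13 (the set `E` of shifted partials with distinct trailing monomials),
Lemma 6.2 (the common factor `(x+α)^a`).

This file holds the DEFINITIONS of the val-lit formalisation of Forbes 2015 Prop. 6.5 (`m = 1`)
= FSV 2018 Lemma 36 (discharge of the named fact `FSV2018_lemma36` with the characteristic clause
of its source); the proofs are in `Forbes15TrailingMonomials`, `Forbes15ShiftedPartials`,
`Forbes15SupportBound`, `Forbes15SmallSupportMonomials` (all theorems).  Standard derivatives
`MvPolynomial.pderiv` replace Hasse derivatives (only first-order derivatives in distinct
variables are used), and an ABSTRACT monomial rank `r : (σ →₀ ℕ) →+ Λ` (additive, injective,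
monotone, linearly ordered cancellative values) replaces Mathlib's `MonomialOrder` (whose API is
about leading monomials); the application uses the lexicographic rank `lexRank`.

* `IsTrailing r f e` — `e` is the `r`-trailing monomial of `f` (§3.2).
* `shiftDeriv α i = (x_i + α_i)∂_{x_i}`, `shiftDerivList`, `listIndicator` (§5.2, the operators
  `((x+α)∘∂_x)`; along a list of distinct variables `shiftDerivList = (x+α)^{1_L}∂_{x^{1_L}}`).
* `LogAffine α u` — `(x_i+α_i)∂_i u ∈ F·u` for all `i` (the multipliers `λ(x+α)^a`, Lemma 6.2).
* `stage u G d t r` — span of `u·G^{d−j}·P`, `j ≤ r`, `deg P ≤ tj` (Lemma 6.2 / Cor. 6.3, `f = y^d`).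
* `ubFamily` (Cor. 6.4's spanning family `u_i G_i^{d_i−j} x^c`), `measure` (the span of
  `x^c (x+α)^{1_B}∂_{x^{1_B}} g`, `|B| = k`, `deg c ≤ ℓ`).
* `complEmb`, `LBIndex`, `LBIndex.shift`, `lbFamily`, `lbExponent` — Lemma 4.13's index set `E`
  (`k`-subsets `B` and shifts in the variables outside `B`), its members and trailing exponents.
* `lexRank`, `embOf`, `killVar` — the lexicographic rank and the projection-with-renaming `ψ`
  of Lemma 4.12 (`x_j ↦ x_{j'}` on `S`, `x_j ↦ 0` off `S`).
-/

open MvPolynomial Finsupp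

namespace Literature.Computability.AlgebraicComplexity.Forbes15

variable {σ F Λ : Type*} [Field F] [AddCommMonoid Λ] [LinearOrder Λ]

/-! ### Trailing monomials for an abstract rank (§3.2) -/

/-- `e` is the **trailing monomial** of `f` for the rank `r` («the smallest monomial in
`Supp(f)`», Forbes §3.2): its coefficient is nonzero and it is `r`-below every monomial of `f`.
[cite: Forbes2015, §3.2 (trailing monomial)] -/
def IsTrailing (r : (σ →₀ ℕ) →+ Λ) (f : MvPolynomial σ F) (e : σ →₀ ℕ) : Prop :=
  coeff e f ≠ 0 ∧ ∀ d ∈ f.support, r e ≤ r d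

/-! ### The operators `(x_i + α_i) ∂_{x_i}` (§5.2) -/

/-- Forbes's operator `(x_i + α_i)·∂_{x_i}` (a member of `((x + α) ∘ ∂_x)^{≤1}`).
[cite: Forbes2015, §5.2 (the measure `((x+α)∘∂_x)^{≤k}`)] -/
noncomputable def shiftDeriv (α : σ → F) (i : σ) : MvPolynomial σ F →ₗ[F] MvPolynomial σ F :=
  LinearMap.mulLeft F (X i + C (α i)) ∘ₗ (MvPolynomial.pderiv i).toLinearMap

/-- The composite `(x_{i₁} + α_{i₁})∂_{i₁} ∘ ⋯ ∘ (x_{iᵣ} + α_{iᵣ})∂_{iᵣ}` along a list; for a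
list of DISTINCT variables it equals `(x + α)^{1_L} ∂_{x^{1_L}}`. [cite: Forbes2015, §5.2] -/
noncomputable def shiftDerivList (α : σ → F) :
    List σ → (MvPolynomial σ F →ₗ[F] MvPolynomial σ F)
  | [] => LinearMap.id
  | i :: L => shiftDeriv α i ∘ₗ shiftDerivList α L

/-- The exponent vector `1_L = Σ_{i ∈ L} e_i` of a list of variables. [cite: Forbes2015, §5.2] -/
noncomputable def listIndicator : List σ → (σ →₀ ℕ)
  | [] => 0
  | i :: L => single i 1 + listIndicator L

/-- Unfolding `(x_i + α_i)∂_{x_i}`. [cite: Forbes2015, §5.2] -/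
@[simp] theorem shiftDeriv_apply (α : σ → F) (i : σ) (f : MvPolynomial σ F) :
    shiftDeriv α i f = (X i + C (α i)) * MvPolynomial.pderiv i f := rfl

/-- The empty composite is the identity. [cite: Forbes2015, §5.2] -/
@[simp] theorem shiftDerivList_nil (α : σ → F) (f : MvPolynomial σ F) :
    shiftDerivList α [] f = f := rfl

/-- Unfolding the composite along `i :: L`. [cite: Forbes2015, §5.2] -/
@[simp] theorem shiftDerivList_cons (α : σ → F) (i : σ) (L : List σ) (f : MvPolynomial σ F) :
    shiftDerivList α (i :: L) f = shiftDeriv α i (shiftDerivList α L f) := rfl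

/-- `1_[] = 0`. [cite: Forbes2015, §5.2] -/
@[simp] theorem listIndicator_nil : (listIndicator ([] : List σ)) = 0 := rfl

/-- `1_{i :: L} = e_i + 1_L`. [cite: Forbes2015, §5.2] -/
@[simp] theorem listIndicator_cons (i : σ) (L : List σ) :
    listIndicator (i :: L) = single i 1 + listIndicator L := rfl

/-! ### Log-affine multipliers and the stages (Lemma 6.2, Cor. 6.3/6.4) -/

/-- `u` is **log-affine** for the shift `α`: every operator `(x_i + α_i)∂_{x_i}` maps `u` into
`F·u`.  Examples: constants, `x_j + α_j`, and every `λ·(x+α)^a` — Forbes Lemma 6.2: «the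
polynomial `(x+α)^a` is a common factor and thus does not contribute to the dimension».
[cite: Forbes2015, Lemma 6.2] -/
def LogAffine (α : σ → F) (u : MvPolynomial σ F) : Prop :=
  ∀ i, ∃ c : F, (X i + C (α i)) * MvPolynomial.pderiv i u = c • u

/-- Stage `r`: the span of `u · G^{d−j} · P` with `j ≤ r` and `deg P ≤ t·j` — where
`((x+α)∘∂)^{≤ r}` applied to `u·G^d` lands (Forbes Lemma 6.2 + Cor. 4.4 for `f(y) = y^d`).
[cite: Forbes2015, Lemma 6.2, Cor. 6.3] -/
noncomputable def stage (u G : MvPolynomial σ F) (d t r : ℕ) : Submodule F (MvPolynomial σ F) :=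
  Submodule.span F
    {q | ∃ j ≤ r, ∃ P : MvPolynomial σ F, P.totalDegree ≤ t * j ∧ q = u * G ^ (d - j) * P}

/-- The spanning family of Cor. 6.4 (`m = 1`): `u_i · G_i^{d_i − j} · x^c`, `i < s`, `j ≤ k`,
`deg c ≤ D` (`D = tk + ℓ`). [cite: Forbes2015, Cor. 6.4] -/
noncomputable def ubFamily {s : ℕ} (u G : Fin s → MvPolynomial σ F) (d : Fin s → ℕ) (D k : ℕ) :
    Fin s × Fin (k + 1) × {c : σ →₀ ℕ // c.degree ≤ D} → MvPolynomial σ F :=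
  fun x => u x.1 * G x.1 ^ (d x.1 - x.2.1) * monomial x.2.2.1 1

/-- **The measure** `span{ x^c · (x+α)^{1_B}∂_{x^{1_B}} g : |B| = k, deg c ≤ ℓ }` — the
sub-family of Forbes's `x^{≤ℓ}((x+α)∘∂_x)^{≤k}` used in the lower bound of Lemma 4.13 (squarefree
derivatives of order exactly `k`). [cite: Forbes2015, §6 (measure `x^{≤ℓ}((x+α)∘∂_x)^{≤k}`)] -/
noncomputable def measure [Fintype σ] (α : σ → F) (g : MvPolynomial σ F) (k ℓ : ℕ) :
    Submodule F (MvPolynomial σ F) :=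
  Submodule.span F {q | ∃ B : Finset σ, B.card = k ∧ ∃ c : σ →₀ ℕ, c.degree ≤ ℓ ∧
    q = monomial c 1 * shiftDerivList α B.toList g}

/-! ### Lemma 4.13's index set `E` -/

/-- An embedding `Fin (n − k) ↪ Fin n` onto the complement of a `k`-set `B`.
[cite: Forbes2015, Lemma 4.13 («`c` in those `n − k` variables not in the support of `b`»)] -/
noncomputable def complEmb {n k : ℕ} (B : Finset (Fin n)) (hB : B.card = k) : Fin (n - k) ↪ Fin n :=
  (Bᶜ.orderEmbOfFin (by rw [Finset.card_compl, Fintype.card_fin, hB])).toEmbedding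

/-- The index set of Forbes's `E` (Lemma 4.13): a `k`-subset `B` (the squarefree derivative
`∂_{x^{1_B}}`) and a shift exponent of degree `≤ ℓ` in the `n − k` variables outside `B`.
[cite: Forbes2015, Lemma 4.13 (the set `E`)] -/
abbrev LBIndex (n k ℓ : ℕ) : Type :=
  {B : Finset (Fin n) // B.card = k} × {c : Fin (n - k) →₀ ℕ // c.degree ≤ ℓ}

/-- The shift exponent `c` of an index, pushed into the `n` variables (supported outside `B`).
[cite: Forbes2015, Lemma 4.13] -/
noncomputable def LBIndex.shift {n k ℓ : ℕ} (x : LBIndex n k ℓ) : Fin n →₀ ℕ :=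
  embDomain (complEmb x.1.1 x.1.2) x.2.1

/-- The lower-bound family `x^c · (x+α)^{1_B}∂_{x^{1_B}} g`, `(B, c) ∈ E`.
[cite: Forbes2015, Lemma 4.13 / Subclaim 4.14] -/
noncomputable def lbFamily {n : ℕ} (α : Fin n → F) (g : MvPolynomial (Fin n) F) (k ℓ : ℕ) :
    LBIndex n k ℓ → MvPolynomial (Fin n) F :=
  fun x => monomial x.shift 1 * shiftDerivList α x.1.1.toList g

/-- The trailing exponent `a − 1_B + c` of the member `(B, c)`. [cite: Forbes2015, Subclaim 4.14] -/
noncomputable def lbExponent {n k ℓ : ℕ} (a : Fin n →₀ ℕ) (x : LBIndex n k ℓ) : Fin n →₀ ℕ :=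
  x.shift + (a - listIndicator x.1.1.toList)

/-! ### The lexicographic rank and the projection `ψ` (§3.2, Lemma 4.12) -/

/-- The lexicographic order on exponents as an additive rank (injective and monotone).
[cite: Forbes2015, §3.2 (monomial orders)] -/
def lexRank (ι : Type*) : (ι →₀ ℕ) →+ Lex (ι →₀ ℕ) where
  toFun := toLex
  map_zero' := rfl
  map_add' _ _ := rfl

/-- An enumeration `Fin |S| ↪ ι` of a finite set of variables. [cite: Forbes2015, Lemma 4.12] -/
noncomputable def embOf {ι : Type*} (S : Finset ι) : Fin S.card ↪ ι :=
  ⟨fun j => (S.equivFin.symm j).1, fun _ _ h => S.equivFin.symm.injective (Subtype.ext h)⟩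

open Classical in
/-- The variables of the projection `ψ`: `X_j ↦ X_{j'}` for `j = embOf S j' ∈ S`, `X_j ↦ 0`
otherwise (Forbes's `π_S`, Lemma 4.12, followed by the renaming `S ≅ Fin |S|`).
[cite: Forbes2015, Lemma 4.12] -/
noncomputable def killVar {ι : Type*} (S : Finset ι) (j : ι) : MvPolynomial (Fin S.card) F :=
  if h : j ∈ S then X (S.equivFin ⟨j, h⟩) else 0

end Literature.Computability.AlgebraicComplexity.Forbes15
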